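import Summits.QuantumFields.BalabanUV.T4Continuum.Support.WeightRouteJunction
import Literature.MathematicalPhysics.QuantumFieldTheory.Balaban1983to89.T4ApexVariance
import HarnessLib

/-!
# NE7Route1ApexSeam — route #1 of the NE7 crux (node U5): the END → APEX seam in kernel, BY NAME

Cell `pub-balaban`, rung (B)+1 sub-cell t4, lineage `b2b-balaban-t4-ne7-p1`, generation 50 (CRUX PROVER NE7 #1, ruling e34b3e0c (2));
crux skeleton `t4/skeletons/NE7-CRUX-R1.md` v1.7.10 §0 («Consumers (kernel, proved)») ∕ §2 (`CruxDecl_of`).  HONEST FRAMING (page 1): FIXED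
FINITE T⁴, rung (B)+1; NE7 is the cell's OWN estimate, NOT PRINTED in [Balaban1984PropagatorsI]–[Balaban1989LargeFieldII] and NOT PROVED
here; continuum YM on T⁴ ⇐ BetaPertH ∧ nine spine estimates (0/9 proved); BetaPertH ⇐ (D1) ∧ (D4) ∧ CAP+tail; G-an2-4 gates asym, D1 and
NE2/3/4; NOT infinite volume, NOT mass gap, NOT Clay.

WHAT ([folklore] bookkeeping; 0 def; 0 sorry; two theorem applications each).  Until now the top of route #1 — road P1's END shape
`T4GoodClassBudget.GoodClause l₀ vol T · · Bad δ ∧ Summable δ` (`TermwiseLocal.goodClause_summable_UN_levels_of_thm1At_residualW`,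
p215546) ⇒ stub S6 junction `WeightRoute.hybridNE7_tail_of_goodClause` ⇒ `T4MatchingAssembly.HybridNE7` ⇒ node U5
`T4ApexVariance.StringwiseMatching` — was composed «by name» in prose (skeleton §0) and seam-read pairwise.  This file states the seam as
ONE theorem per level, so that the composition END → U5 is two kernel applications (the END, then this file) and the interface NODE O's
E1∕E2 dictionary must meet is displayed in one place:
 * **`stringwiseMatching_of_route1_end`** (scheme level, any `TorusScheme` with `β_K ≥ 0` and measurable observables bounded by `1`): per
   string `os`, SOME finite term data `(ι, T, A, B, shA, shB, Bad, W, Wsh, δ)` with radius `l₀ > 0`, volume factor `vol > 0`, NE7b's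
   `RelWeightBound l₀ T A B Bad W`, NE7c's `ShellWeightBound l₀ T A B shA shB Wsh`, `Summable δ`, road P1's END shape `GoodClause` ON THE
   HYBRID CORES `A − shA`, `B − shB` (the END is fed the cores; its format binders `hfmtA`∕`hfmtB` then read the core integrals), and the
   UNSHIFTED dictionary `schemeZ S os K t = Σ_{τ ∈ T K} A K t τ`, `schemeZ S os (K+1) t = Σ_{τ ∈ T K} B K t τ` on `|t| ≤ l₀` (FULL terms;
   nodes E1∕E2) ⇒ `StringwiseMatching S`.  The offset `K₀` of `T4MatchingAssembly.StringHybridNE7` is PRODUCED (the two weight structures'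
   own summability, `hybridNE7_tail_of_goodClause`) and the dictionary re-indexed — no `W K + Wsh K < 1` hypothesis, no offset asked of NODE O.
 * **`matchingUnder_of_route1_end`** — the same under the prefix for Bałaban's data: `T4ApexVariance.MatchingUnder D Hβ`.
Located checks this file settles in kernel (recorded, none failed): the class constant's quantifier order (`∀ K ∃ c ∀ t ∀ τ` on both sides),
the core∕shell split, the `K₀` re-indexing of the dictionary, the universe of the index type (`ι : Type`, as `StringHybridNE7` takes it), the
instance path `GaugeGroup ∕ RegularGaugeGroup ∕ HaarData`.
HONEST: composition only (junction p1-lineage `WeightRouteJunction` + Literature `T4MatchingAssembly`∕`T4ApexHybrid`∕`T4ApexVariance`);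
every input is a HYPOTHESIS SHAPE asserted for nothing; nothing of Bałaban's instantiated or discharged; route 1 stays KERNEL-COMPLETE AT
FORM LEVEL ∕ DEPENDENT (NE3 covariant root, NODE O, NE5, NE9, NE7b∕c, NE4∕(CONV-C), β-road); NE7 NOT proved; spine 0∕9.
-/

set_option autoImplicit false

open Finset MeasureTheory

namespace Summit.QuantumFields.BalabanUV.T4Continuum.NE7Route1ApexSeam

open Literature.MathematicalPhysics.QuantumFieldTheory.Balaban1983to89
open Missing T4Continuum T4WeightBudget T4IndicatorShell T4GoodClassBudget T4MatchingAssembly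
open Summit.QuantumFields.BalabanUV.T4Continuum.WeightRoute (hybridNE7_tail_of_goodClause)

universe u

section Scheme

variable {G : Type*} [GaugeGroup G] [MeasurableSpace G] [RegularGaugeGroup G] [HaarData G] {O : Type*}

/-- **ROUTE #1's END → APEX SEAM, scheme level.**  For a scheme with `β_K ≥ 0` and measurable observables bounded by `1`: if every string
`os` carries SOME finite term data with `0 < l₀`, `0 < vol`, NE7b's `RelWeightBound`, NE7c's `ShellWeightBound`, a summable term-wise
remainder, road P1's END shape `GoodClause` ON THE HYBRID CORES `A − shA`, `B − shB`, and NODE O's UNSHIFTED E1∕E2 dictionary for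
`schemeZ S os` on `|t| ≤ l₀`, then node U5 holds: `T4ApexVariance.StringwiseMatching S`.  (`hybridNE7_tail_of_goodClause` produces the
offset `K₀`; the dictionary is re-indexed; `stringwiseMatching_of_stringwiseHybridNE7`.)  Every input is a hypothesis shape; nothing
printed is asserted. [folklore] -/
theorem stringwiseMatching_of_route1_end (S : TorusScheme G O) (hβ : ∀ K, 0 ≤ S.β K)
    (hm : ∀ K o, Measurable (S.obs K o)) (h1 : ∀ K o U, |S.obs K o U| ≤ 1)
    (h : ∀ os : List O, ∃ (ι : Type) (_ : DecidableEq ι) (l₀ vol : ℝ) (T : ℕ → Finset ι)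
        (A B shA shB : ℕ → ℝ → ι → ℝ) (Bad : ℕ → ℝ → Finset ι) (W Wsh δ : ℕ → ℝ),
        0 < l₀ ∧ 0 < vol ∧
        RelWeightBound l₀ T A B Bad W ∧ ShellWeightBound l₀ T A B shA shB Wsh ∧ Summable δ ∧
        GoodClause l₀ vol T (fun K t τ => A K t τ - shA K t τ) (fun K t τ => B K t τ - shB K t τ) Bad δ ∧
        (∀ K t, |t| ≤ l₀ → T4GenFunBounds.schemeZ S os K t = ∑ τ ∈ T K, A K t τ) ∧
        (∀ K t, |t| ≤ l₀ → T4GenFunBounds.schemeZ S os (K + 1) t = ∑ τ ∈ T K, B K t τ)) :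
    T4ApexVariance.StringwiseMatching S := by
  refine T4ApexVariance.stringwiseMatching_of_stringwiseHybridNE7 S hβ hm h1 fun os => ?_
  obtain ⟨ι, _, l₀, vol, T, A, B, shA, shB, Bad, W, Wsh, δ, hl₀, hvol, hW, hSh, hδ, hcore, hZA, hZB⟩ := h os
  obtain ⟨K₀, hH⟩ := hybridNE7_tail_of_goodClause (vol := vol) hW hSh hδ hcore
  refine ⟨l₀, vol, K₀, hl₀, hvol, ι, ‹DecidableEq ι›, _, _, _, _, _, _, _, _, _, hH, ?_, ?_⟩
  · intro K t ht
    simpa using hZA (K₀ + K) t ht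
  · intro K t ht
    simpa [Nat.add_assoc] using hZB (K₀ + K) t ht

end Scheme

section Prefix

variable {F : T4Family} {G : Type u} [GaugeGroup G] [MeasurableSpace G] [RegularGaugeGroup G] [HaarData G]

/-- **The same seam UNDER THE PREFIX for Bałaban's data** (`FiniteEpsData`, measurable averaging maps — the averaged loop variables are
measurable and bounded by `1`, `FiniteEpsData.measurable_avgObs` ∕ `abs_avgObs_le_one`; `β_K ≥ 0` by `scheme_β_eq`): if under the
hypotheses `Hβ` every tuned scheme `D.scheme g₀` carries, per string, the route-1 END shape on the hybrid cores + stub S6's two weight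
structures + NODE O's unshifted dictionary, then `T4ApexVariance.MatchingUnder D Hβ` (node U5 under the prefix).  Hypothesis shapes only;
nothing printed is asserted. [folklore] -/
theorem matchingUnder_of_route1_end (D : FiniteEpsData F G) (hM : D.AvgMeasurable) {Hβ : Prop}
    (h : D.UnderHypotheses Hβ fun g₀ => ∀ os, ∃ (ι : Type) (_ : DecidableEq ι) (l₀ vol : ℝ) (T : ℕ → Finset ι)
        (A B shA shB : ℕ → ℝ → ι → ℝ) (Bad : ℕ → ℝ → Finset ι) (W Wsh δ : ℕ → ℝ),
        0 < l₀ ∧ 0 < vol ∧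
        RelWeightBound l₀ T A B Bad W ∧ ShellWeightBound l₀ T A B shA shB Wsh ∧ Summable δ ∧
        GoodClause l₀ vol T (fun K t τ => A K t τ - shA K t τ) (fun K t τ => B K t τ - shB K t τ) Bad δ ∧
        (∀ K t, |t| ≤ l₀ → T4GenFunBounds.schemeZ (D.scheme g₀) os K t = ∑ τ ∈ T K, A K t τ) ∧
        (∀ K t, |t| ≤ l₀ → T4GenFunBounds.schemeZ (D.scheme g₀) os (K + 1) t = ∑ τ ∈ T K, B K t τ)) :
    T4ApexVariance.MatchingUnder D Hβ :=
  FiniteEpsData.UnderHypotheses.mono (fun g₀ hg =>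
    stringwiseMatching_of_route1_end (D.scheme g₀) (fun K => (D.scheme_β_eq g₀ K).2)
      (fun K C => D.measurable_avgObs hM K C) (fun K C U => D.abs_avgObs_le_one K C U) hg) h

end Prefix

end Summit.QuantumFields.BalabanUV.T4Continuum.NE7Route1ApexSeam
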